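/-
Copyright (c) 2026 the pub-hodgecm-mathlib formalisation cell (harness21).  Prover seat hodgecm-mathlib-F0P3-p02 (g18): line LH3 (closer stub `stub_N9`), organ J,
sliver (b1) «hγβ + hvert» of LH3-p02 (g3)'s (G′-SIDE) census (2026-09-02T08:56:59Z).
-/
import Literature.NumberTheory.Automorphic.ArchInnerFormSemiregularCentralizerBlockCayley   -- ★ p850544 (LH5-p02 (g3)) (M-UNFOLD) [5β]∕[6β]: `gprimeTorus_insert_mem_centralizer`, `boostStd` (via the atlas)
import Literature.NumberTheory.Rogawski1990.ArchCayleyValueOfMembership                    -- ★ p850419 (LH4-p01 (g3)) (V1-G′): the `x`-ray `hcCayPt w i j p + x • e_{w,0}`, `cayRay_apply_self_*` (+ ★ docks, ★ `ArchHCSpaceG`)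
import Literature.NumberTheory.Automorphic.ArchRankOneSplitOrbitContinuity                 -- ★ p850189 (F0P3a-p05 (g19)) (A0-b): `hypBlockGL_mem_of_eq_over` (the `hJ` currency of the split torus element)
import HarnessLib

/-!
# (J-G′-BLOCK-β-INST): the block coordinates of the Cayley-chart point along the `x`-ray — `(diag(e^{x+iθ}, e^{−x+iθ}), r₀)` with the SAME frozen `r₀` as on the compact chart
# (Rogawski 1990 §8.2 p. 122, §3.6 p. 31; Shelstad 1979 §4 p. 25)

Topic `NumberTheory/Rogawski1990`; namespace `Literature.NumberTheory.Rogawski1990`.  THEOREMS ONLY (no `def`, no instance, no notation, no axiom, no named fact, no `sorry`);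
kernel lane `--kind proof --supports stmt-HodgeConjecture-24833`.  Cell `pub/hodgecm-mathlib`, crux H413 (`stmt-HodgeConjecture-24833`), F0∕P3c line LH3 (closer stub `stub_N9`,
DIRECT ROAD `F0_P3c_StubN9Direct`, organ J, residual stub `stub_N9jumpGSide`), sliver **(b1) «hγβ + hvert»** of LH3-p02 (g3)'s (G′-SIDE) census (2026-09-02T08:56:59Z; seat F0P3-p02
(g18)) — the Cayley-chart twin of ★ (J-G′-BLOCK-INST) `eM_gprimeTorus_add_smul_hcNrm_eq` (p850492, this seat): the binder `hγβ` of ★ (J-G′-BLOCK-β) `ArchChartOrbGBlockReductionSplit`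
(p850444, F0P3b-p01 (g15)) and the binder `hvert` of ★ p850462 §4, DISCHARGED IN BINDER FORM over the clauses [5β] + [6β] of ★ (M-UNFOLD) `…_semireg_cayley` (p850544, LH5-p02 (g3):
the `B`-component of `gprimeTorus (insert w₀ S) c` is the `{0,2}`-block of the standard boost, its `K`-component is `gprimeTorus S (update c w₀ (0, c_{w₀,1}, 0))`), clause [6] of ★ p850446
(the same `K`-reading on the compact chart), and (B-STD) (iii) ★ `std_eq_hypBlockGL_of_coe_eq_boost` (p850661, LH3-p02∕F0P3a-p07: `φ` reads the boost block as `diag(e^{x+iθ}, e^{−x+iθ})`)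
taken as a hypothesis `hφβ` on an ABSTRACT `φ : ↥B ≃ₜ* ↥U(J)`, for an ABSTRACT standardised `e′` with `he′ : ∀ g, e′ g = (φ (e g).1, (e g).2)` (never spelling the composite).

THE MATHEMATICS.  At a point `p` ON the compact wall `θ₀ = θ₂` of `w₀ ∉ S` (`w₀` a split-chart place) the wall point `γ_p = gprimeTorus S p` is ALSO the Cayley point of the
split chart `S♯ = insert w₀ S` (★ `gprimeTorus_of_wall`, ★ `hcCayPt_eq_of_wall`).  Along the `x`-RAY `c_x = hcCayPt w₀ 0 2 p + x • e_{w₀,0}` of `S♯` (★ (V1-G′): `x_{w₀} = x`,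
compact-line angle `p_{w₀,1}`, phase `θ = p_{w₀,0}`, other places frozen) the chart point `gprimeTorus S♯ c_x` lies in `Z(γ_p)` (★ `gprimeTorus_insert_mem_centralizer`) and, in
the standardised block coordinates `e′ = (φ × id) ∘ e`: (1) its `U(J)`-component is `φ(boost block) = diag(e^{x+iθ}, e^{−x+iθ}) = hypBlockGL x (p w₀ 0)` ([5β] + (iii)); (2) its
`K`-component reads only `update c_x w₀ (0, (c_x)_{w₀,1}, 0) = update p w₀ (0, p_{w₀,1}, 0)`, i.e. it is the SAME `r₀ = (e γ_p).2` as along the compact-wall normal ([6β], [6]) — so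
the block test function `f_B = (a′)_M^β ∘ e′⁻¹(·, r₀)` is LITERALLY THE SAME on both charts (organ J's ratio); (3) at `x = 0`: `e′⁻¹(hypBlockGL 0 θ, r₀) = γ_p` (`hvert`).

* §1 coordinates of the `x`-ray: `cayRay_apply_self_two_of_wall` (`= p w₀ 0` on the wall), `update_cayRay_eq` (the frozen complementary coordinate; ★ `cayRay_apply_of_ne`), `cayRay_zero_eq_hcCayPt`;
* §2 `e_gprimeTorus_insert_cayRay_snd_eq` ([6β]+[6]: `(e γ_{c_x}).2 = (e γ_p).2`);
* §3 **`eM_gprimeTorus_insert_cayRay_eq`** (`hγβ`: `e′ γ_{c_x} = (⟨hypBlockGL x (p w₀ 0), _⟩, (e γ_p).2)`) and **`coe_symm_hypBlockGL_zero_eq_gprimeTorus`** (`hvert`).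
HONEST LABEL: HC_CM is proved only modulo the 7 printed citations (2 remaining named inputs: hLiu418 = `stmt-HodgeConjecture-24832`, h413 = `stmt-HodgeConjecture-24833`) until rung 0
closes; count-neutral coordinate bookkeeping under organ J of `stub_N9` (no stub closes by this file alone).

## References
* [Rogawski1990] J. D. Rogawski, *Automorphic Representations of Unitary Groups in Three Variables*, Ann. of Math. Stud. 123 (1990), §8.2 p. 122 (the split torus of `U(1,1)` at the
  Cayley point), §3.6 p. 31 (`diag(e^{x+iθ}, e^{−x+iθ})`), §4.9 p. 54.
* [Shelstad1979] D. Shelstad, *Characters and inner forms of a quasi-split group over ℝ*, Compositio Math. 39 (1979), §4 p. 25 (the Cayley transform at a wall, the ray `x → 0`).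
-/

set_option autoImplicit false

noncomputable section

open Set Filter Topology NumberField NumberField.InfinitePlace
open Literature.NumberTheory.Automorphic Literature.NumberTheory.Automorphic.UnitaryGroup Literature.NumberTheory.Automorphic.ArchCartan
open scoped MatrixGroups Matrix Classical

namespace Literature.NumberTheory.Rogawski1990

/-! ## §1 Coordinates of the `x`-ray at the wall place -/

section Coordinates

variable {W : Type*} [DecidableEq W] (p : W → Fin 3 → ℝ) (w₀ : W)

/-- ON the wall `p w₀ 0 = p w₀ 2` the phase slot of the `x`-ray is `p w₀ 0`. [cite: Shelstad1979, §4 p. 25] [cite: Rogawski1990, §8.2 p. 122] -/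
theorem cayRay_apply_self_two_of_wall (hp : p w₀ 0 = p w₀ 2) (x : ℝ) :
    (hcCayPt w₀ 0 2 p + x • (Pi.single w₀ (Pi.single 0 1 : Fin 3 → ℝ) : W → Fin 3 → ℝ)) w₀ 2 = p w₀ 0 := by
  rw [cayRay_apply_self_two, ← hp, add_self_div_two]

/-- The complementary coordinate is frozen along the `x`-ray: zeroing the two block slots of `c_x` gives the same point as for `p` (slot `1` of the ray is `p w₀ 1`, the other
places are `p`'s). [cite: Shelstad1979, §4 p. 25] -/
theorem update_cayRay_eq (x : ℝ) :
    Function.update (hcCayPt w₀ 0 2 p + x • (Pi.single w₀ (Pi.single 0 1 : Fin 3 → ℝ) : W → Fin 3 → ℝ)) w₀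
        ![0, (hcCayPt w₀ 0 2 p + x • (Pi.single w₀ (Pi.single 0 1 : Fin 3 → ℝ) : W → Fin 3 → ℝ)) w₀ 1, 0] =
      Function.update p w₀ ![0, p w₀ 1, 0] := by
  rw [cayRay_apply_self_one, hcThird_zero_two]
  funext w
  by_cases hw : w = w₀
  · subst hw; simp only [Function.update_self]
  · simp only [Function.update_of_ne hw, cayRay_apply_of_ne p hw]

/-- At `x = 0` the ray sits at the Cayley point. [cite: Shelstad1979, §4 p. 25] -/
theorem cayRay_zero_eq_hcCayPt : hcCayPt w₀ 0 2 p + (0 : ℝ) • (Pi.single w₀ (Pi.single 0 1 : Fin 3 → ℝ) : W → Fin 3 → ℝ) = hcCayPt w₀ 0 2 p := by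
  rw [zero_smul, add_zero]

end Coordinates

/-! ## §2 The Cayley-chart point of the `x`-ray in the block coordinates `e` of ★ (M-UNFOLD) -/

section Block

variable (L : Type) [Field L] [NumberField L] [IsCMField L] (α : Fin 3 → L)
  (S : Finset {w : InfinitePlace L // IsComplex w}) (w₀ : {w : InfinitePlace L // IsComplex w}) (p : {w : InfinitePlace L // IsComplex w} → Fin 3 → ℝ)
  (hw₀ : w₀ ∉ S) (hsp : w₀ ∈ splitChartPlaces L α) (hp : p w₀ 0 = p w₀ 2)
  {B : Subgroup (GL (Fin 2) ℂ)}
  (K : Subgroup ↥(Subgroup.centralizer ({gprimeTorus L α S p} : Set ↥(arch (↥(maximalRealSubfield L)) L (IsCMField.complexConj L) 3 (Matrix.diagonal α)))))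
  (e : ↥(Subgroup.centralizer ({gprimeTorus L α S p} : Set ↥(arch (↥(maximalRealSubfield L)) L (IsCMField.complexConj L) 3 (Matrix.diagonal α)))) ≃ₜ* ↥B × ↥K)
  -- clause [6] of ★ `exists_continuousMulEquiv_centralizer_gprimeTorus_semireg` (the `K`-reading on the compact chart)
  (h6 : ∀ c : {w : InfinitePlace L // IsComplex w} → Fin 3 → ℝ,
    (((e ⟨gprimeTorus L α S c, gprimeTorus_mem_centralizer L α S p c⟩).2 : ↥(Subgroup.centralizer ({gprimeTorus L α S p} : Set ↥(arch (↥(maximalRealSubfield L)) L (IsCMField.complexConj L) 3 (Matrix.diagonal α))))) :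
        ↥(arch (↥(maximalRealSubfield L)) L (IsCMField.complexConj L) 3 (Matrix.diagonal α))) =
      gprimeTorus L α S (Function.update c w₀ ![0, c w₀ 1, 0]))
  -- clause [6β] of ★ `exists_continuousMulEquiv_centralizer_gprimeTorus_semireg_cayley` (the `K`-reading on the Cayley chart)
  (h6β : ∀ c : {w : InfinitePlace L // IsComplex w} → Fin 3 → ℝ,
    (((e ⟨gprimeTorus L α (insert w₀ S) c, gprimeTorus_insert_mem_centralizer L α hw₀ hsp hp c⟩).2 : ↥(Subgroup.centralizer ({gprimeTorus L α S p} : Set ↥(arch (↥(maximalRealSubfield L)) L (IsCMField.complexConj L) 3 (Matrix.diagonal α))))) :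
        ↥(arch (↥(maximalRealSubfield L)) L (IsCMField.complexConj L) 3 (Matrix.diagonal α))) =
      gprimeTorus L α S (Function.update c w₀ ![0, c w₀ 1, 0]))

include h6 h6β in
/-- **[6β] + [6] ON THE `x`-RAY — THE COMPLEMENTARY COORDINATE IS FROZEN AT THE COMPACT CHART'S `r₀`**: `(e γ_{c_x}).2 = (e γ_p).2` for every `x`. [cite: Shelstad1979, §4 p. 25]
[cite: Rogawski1990, §8.2 p. 122; §3.6 p. 31] -/
theorem e_gprimeTorus_insert_cayRay_snd_eq (x : ℝ) :
    (e ⟨gprimeTorus L α (insert w₀ S) (hcCayPt w₀ 0 2 p + x • (Pi.single w₀ (Pi.single 0 1 : Fin 3 → ℝ) : _ → Fin 3 → ℝ)), gprimeTorus_insert_mem_centralizer L α hw₀ hsp hp _⟩).2 =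
      (e ⟨gprimeTorus L α S p, gprimeTorus_mem_centralizer L α S p p⟩).2 := by
  apply Subtype.ext
  apply Subtype.ext
  rw [h6β, h6, update_cayRay_eq]

end Block

/-! ## §3 `hγβ` and `hvert` for the standardised block equivalence -/

section Standard

variable (L : Type) [Field L] [NumberField L] [IsCMField L] (α : Fin 3 → L)
  (S : Finset {w : InfinitePlace L // IsComplex w}) (w₀ : {w : InfinitePlace L // IsComplex w}) (p : {w : InfinitePlace L // IsComplex w} → Fin 3 → ℝ)
  (hw₀ : w₀ ∉ S) (hsp : w₀ ∈ splitChartPlaces L α) (hp : p w₀ 0 = p w₀ 2)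
  {B : Subgroup (GL (Fin 2) ℂ)}
  (K : Subgroup ↥(Subgroup.centralizer ({gprimeTorus L α S p} : Set ↥(arch (↥(maximalRealSubfield L)) L (IsCMField.complexConj L) 3 (Matrix.diagonal α)))))
  (e : ↥(Subgroup.centralizer ({gprimeTorus L α S p} : Set ↥(arch (↥(maximalRealSubfield L)) L (IsCMField.complexConj L) 3 (Matrix.diagonal α)))) ≃ₜ* ↥B × ↥K)
  (h6 : ∀ c : {w : InfinitePlace L // IsComplex w} → Fin 3 → ℝ,
    (((e ⟨gprimeTorus L α S c, gprimeTorus_mem_centralizer L α S p c⟩).2 : ↥(Subgroup.centralizer ({gprimeTorus L α S p} : Set ↥(arch (↥(maximalRealSubfield L)) L (IsCMField.complexConj L) 3 (Matrix.diagonal α))))) :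
        ↥(arch (↥(maximalRealSubfield L)) L (IsCMField.complexConj L) 3 (Matrix.diagonal α))) =
      gprimeTorus L α S (Function.update c w₀ ![0, c w₀ 1, 0]))
  (b : Fin 3 → ℝ)
  -- clause [5β] of ★ `…_semireg_cayley` (the `B`-component of a Cayley-chart point is the `{0,2}`-block of the standard boost), for an abstract weight vector `b`
  (h5β : ∀ c : {w : InfinitePlace L // IsComplex w} → Fin 3 → ℝ,
    ((((e ⟨gprimeTorus L α (insert w₀ S) c, gprimeTorus_insert_mem_centralizer L α hw₀ hsp hp c⟩).1 : ↥B) : GL (Fin 2) ℂ) : Matrix (Fin 2) (Fin 2) ℂ) =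
      (boostStd b (c w₀)).submatrix ![0, 2] ![0, 2])
  (h6β : ∀ c : {w : InfinitePlace L // IsComplex w} → Fin 3 → ℝ,
    (((e ⟨gprimeTorus L α (insert w₀ S) c, gprimeTorus_insert_mem_centralizer L α hw₀ hsp hp c⟩).2 : ↥(Subgroup.centralizer ({gprimeTorus L α S p} : Set ↥(arch (↥(maximalRealSubfield L)) L (IsCMField.complexConj L) 3 (Matrix.diagonal α))))) :
        ↥(arch (↥(maximalRealSubfield L)) L (IsCMField.complexConj L) 3 (Matrix.diagonal α))) =
      gprimeTorus L α S (Function.update c w₀ ![0, c w₀ 1, 0]))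
  {J : Matrix (Fin 2) (Fin 2) ℂ} (hJ : J = (StdForm.antidiagonal 2).over ℂ)
  (φ : ↥B ≃ₜ* ↥(unitaryGroupOfForm (starRingEnd ℂ) J))
  -- (B-STD) (iii) ★ `std_eq_hypBlockGL_of_coe_eq_boost` as a binder: `φ` reads a boost block as the split torus element
  (hφβ : ∀ (cw : Fin 3 → ℝ) (h : ↥B), (((h : ↥B) : GL (Fin 2) ℂ) : Matrix (Fin 2) (Fin 2) ℂ) = (boostStd b cw).submatrix ![0, 2] ![0, 2] →
    φ h = ⟨hypBlockGL (cw 0) (cw 2), hypBlockGL_mem_of_eq_over hJ (cw 0) (cw 2)⟩)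
  -- the standardised block equivalence, bound abstractly (★ `exists_continuousMulEquiv_prodMap`)
  (e' : ↥(Subgroup.centralizer ({gprimeTorus L α S p} : Set ↥(arch (↥(maximalRealSubfield L)) L (IsCMField.complexConj L) 3 (Matrix.diagonal α)))) ≃ₜ*
    ↥(unitaryGroupOfForm (starRingEnd ℂ) J) × ↥K)
  (he' : ∀ g, e' g = (φ (e g).1, (e g).2))

include h6 h5β h6β hφβ he' in
/-- **`hγβ` ALONG THE `x`-RAY for the standardised block equivalence `e′ = (φ × id) ∘ e`:** on the wall `p w₀ 0 = p w₀ 2`,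
`e′ γ_{hcCayPt w₀ 0 2 p + x • e_{w₀,0}} = (⟨hypBlockGL x (p w₀ 0), _⟩, (e γ_p).2)` — the first component is TOKEN-EXACT the split torus element of ★ (A0-c)
`exists_tendsto_abs_sub_smul_integral_descConj_hypBlockGL_cone` ∕ the shared datum's `hA0` at `θ := p w₀ 0`, the second is the SAME frozen `r₀ := (e γ_p).2` as ★
`eM_gprimeTorus_add_smul_hcNrm_eq` (cross-chart consistency of the block test function). [cite: Rogawski1990, §8.2 p. 122; §3.6 p. 31] [cite: Shelstad1979, §4 p. 25] -/
theorem eM_gprimeTorus_insert_cayRay_eq (x : ℝ) :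
    e' ⟨gprimeTorus L α (insert w₀ S) (hcCayPt w₀ 0 2 p + x • (Pi.single w₀ (Pi.single 0 1 : Fin 3 → ℝ) : _ → Fin 3 → ℝ)), gprimeTorus_insert_mem_centralizer L α hw₀ hsp hp _⟩ =
      (⟨hypBlockGL x (p w₀ 0), hypBlockGL_mem_of_eq_over hJ x (p w₀ 0)⟩, (e ⟨gprimeTorus L α S p, gprimeTorus_mem_centralizer L α S p p⟩).2) := by
  rw [he']
  have h1 := hφβ ((hcCayPt w₀ 0 2 p + x • (Pi.single w₀ (Pi.single 0 1 : Fin 3 → ℝ) : _ → Fin 3 → ℝ)) w₀) _ (h5β _)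
  rw [cayRay_apply_self_zero, cayRay_apply_self_two_of_wall p w₀ hp] at h1
  rw [h1, e_gprimeTorus_insert_cayRay_snd_eq L α S w₀ p hw₀ hsp hp K e h6 h6β x]

include h6 h5β h6β hφβ he' in
/-- **`hvert` — AT `x = 0` THE STANDARDISED COORDINATES `(hypBlockGL 0 (p w₀ 0), r₀)` ARE THOSE OF THE WALL POINT**: `e′⁻¹(⟨hypBlockGL 0 (p w₀ 0), _⟩, (e γ_p).2) = γ_p = gprimeTorus L α S p`
in `G′_∞` (§3 at `x = 0`, ★ `gprimeTorus_of_wall`, ★ `hcCayPt_eq_of_wall`). [cite: Shelstad1979, §4 p. 25] [cite: Rogawski1990, §8.2 p. 122] -/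
theorem coe_symm_hypBlockGL_zero_eq_gprimeTorus :
    ((e'.symm (⟨hypBlockGL 0 (p w₀ 0), hypBlockGL_mem_of_eq_over hJ 0 (p w₀ 0)⟩, (e ⟨gprimeTorus L α S p, gprimeTorus_mem_centralizer L α S p p⟩).2) :
        ↥(Subgroup.centralizer ({gprimeTorus L α S p} : Set ↥(arch (↥(maximalRealSubfield L)) L (IsCMField.complexConj L) 3 (Matrix.diagonal α))))) :
      ↥(arch (↥(maximalRealSubfield L)) L (IsCMField.complexConj L) 3 (Matrix.diagonal α))) = gprimeTorus L α S p := by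
  rw [← eM_gprimeTorus_insert_cayRay_eq L α S w₀ p hw₀ hsp hp K e h6 b h5β h6β hJ φ hφβ e' he' 0, ContinuousMulEquiv.symm_apply_apply]
  show gprimeTorus L α (insert w₀ S) (hcCayPt w₀ 0 2 p + (0 : ℝ) • (Pi.single w₀ (Pi.single 0 1 : Fin 3 → ℝ) : _ → Fin 3 → ℝ)) = gprimeTorus L α S p
  rw [cayRay_zero_eq_hcCayPt, gprimeTorus_of_wall L α hw₀ hsp hp, hcCayPt_eq_of_wall hp, hcThird_zero_two]

end Standard

end Literature.NumberTheory.Rogawski1990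

end
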